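import Summits.Ventures.Crystal3D.Bulk.GapLadderComputational
import Summits.Ventures.Crystal3D.Bulk.GapReductionSharp
import HarnessLib

/-!
# The K-path at `h = 5/4`: `KissingClassification (5/2) → BulkCrystallization3D 702` (computational)

Cell pub-crystal3d (AtomisticToContinuum venture), sprint «GAP(h*)», post-23Z K-path line (RULING #132 (7)).
HONEST FRAMING: this file proves ONE implication and asserts nothing else.  Its hypothesis
`KissingClassification (5/2)` (BIMODAL(1.25): every twelve-point configuration on `S²(2)` with pairwise
distances `2` or `≥ 5/2` is congruent to the FCC or the HCP kissing pattern) is NOT a theorem of the tree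
today (a port of the tree's verified growth search to `κ = 7/32` is sized in
`HOME/lean/kissing125/README.md`); its other input, GAP(1.25) in the form `GapTupleDiam 1.25`, IS a tree
theorem of computational grade (`gapTupleDiam_125`, from `CapX2.noHole_0625 : NoHole 0.625`, standard
axioms + exactly 67 compiled interval evaluations).  Nothing here concerns GAP(1.26) or any census.

* `bulkCrystallization3D_sharp_of_kissingClassification_250 :
    KissingClassification (5/2) → BulkCrystallization3D 702` — the generic glue
  `bulkCrystallization3D_sharp_of_gapTupleDiam_of_classification` (Bulk/GapReductionSharp.lean) at
  `d₀ = 1.25` with the GAP side discharged by `gapTupleDiam_125`; so the K-path at `h = 5/4` has exactly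
  ONE open input, BIMODAL(1.25).
-/

namespace Summit.Ventures.Crystal3D

open Literature.Geometry.DiscreteGeometry

/-- **K-path at `h = 5/4`**: if every `5/2`-gap kissing configuration is FCC or HCP
(`KissingClassification (5/2)`), then every sticky-sphere ground state on `N` balls has all but
`≤ 702·N^{2/3}` balls with an FCC or HCP contact shell — the GAP side being the tree theorem
`gapTupleDiam_125 : GapTupleDiam 1.25` (computational grade, from `CapX2.noHole_0625`). -/
theorem bulkCrystallization3D_sharp_of_kissingClassification_250 (hc : KissingClassification (5 / 2)) :
    BulkCrystallization3D 702 :=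
  bulkCrystallization3D_sharp_of_gapTupleDiam_of_classification gapTupleDiam_125
    (by rw [show (2 : ℝ) * 1.25 = 5 / 2 by norm_num]; exact hc)

end Summit.Ventures.Crystal3D
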